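import Summits.QuantumFields.BalabanUV.Beta.GAN24.MonotoneSqueeze

/-!
# `BalabanUV.Beta.GAN24.MonotoneSqueezeGauge` — binder row G-an2-4 ∕ (CONV-C), routes R1 ∕ R6 ∕ R7: THE GAUGE SPLIT OF ROAD P2's SQUEEZE IN ABSTRACT FORM —
# for ANY minimiser selection `G` of the coarse problem (any gauge) and ANY minimiser selection `G_f` of the fine one, the fine effective form sees the row defect of the
# canonical `harmExt` only through the HONEST defect `C_f·P·G − 1`, and the prolongated coarse minimiser `P·G B` is energy-close to `G_f B`, modulo (PROL), (MONO),
# `‖E_f‖ ≤ Λ` and `nsq (C_f P G B − B) ≤ ρ²·nsq B` (unit b2b-balaban-gan24-p3, gen 49; v1 — the background-ready abstraction of `WhitneyRowDefectGauge`)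

NOT IN PRINT; OUR PROOF ([folklore] finite-dimensional linear algebra over `GAN24/MonotoneSqueeze` ∕ `MonotoneShorted` BY NAME).  HONEST FRAMING (cell contract, verbatim):
«discharging `BetaPertH` makes Bałaban's UV stability UNCONDITIONAL — a real constructive-QFT result; it is NOT the continuum limit and NOT the Clay problem.»  HONEST DEPENDENCY
(verbatim): «continuum YM on T⁴ ⇐ BetaPertH ∧ nine spine estimates (0/9 proved); BetaPertH ⇐ (D1) ∧ (D4) ∧ CAP+tail; G-an2-4 gates asym, D1 and NE2/3/4.»

WHY.  `WhitneyRowDefectGauge` (p392992) performs the gauge split at `U = 1` on road P4's torus avatar with Bałaban's `HkOp`.  Nothing in it uses `U = 1`: the mechanism is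
(i) two minimisers of a positive semidefinite form on one fibre differ by a NULL vector (Pythagoras on the fibre, `MonotoneShorted.quad_harmExt_add`), (ii) (PROL) maps null vectors
to null vectors, (iii) the fine shorted form kills readings of null vectors (`shortForm_mulVec_eq_zero_of_lift`).  THIS FILE states it over the abstract letters of `MonotoneSqueeze`
(degenerate PSD forms `H_c`, `H_f`, surjective averagings `C_c`, `C_f` with sections, a prolongation `P` with (PROL), (MONO)), so that route R6's `U ≠ 1` instantiation (Bałaban's
gauge-fixed minimisers WITH background, covariant averaging, (STAB)∕(PROL) with slack — all UNTYPED today) can plug its own minimiser selections without touching `harmExt`'s gauge.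

CONTENT (0 sorry, 0 `def`, nothing cited):
* §1 **`H_harmExt_sub_mulVec_eq_zero`**: `C_c G = 1` and `re⟨G B, H_c G B⟩ ≤ re⟨B, E_c B⟩` (minimality of the selection `G` at `B`) ⟹ `H_c (harmExt_c B − G B) = 0`.
* §2 `Hf_P_mulVec_of_ker` ((PROL): `H_c z = 0 ⟹ H_f (P z) = 0`), `shortForm_Cf_P_of_ker` (`⟹ E_f (C_f P z) = 0`).
* §3 **`shortForm_rowDefect_mulVec_eq`** (`E_f (R B) = E_f (C_f P G B − B)`), **`rowDefect_quad_eq`** (the quadratic form likewise).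
* §4 **`squeeze_gauge`**, **`energy_dist_gauge`**, **`squeeze_nsq_gauge`** (road P2's ENDs with the honest defect of `G`), **`energy_dist_minimisers`**
  (`re⟨G_f B − P G B, H_f (G_f B − P G B)⟩ ≤ (4Λρ + 2Λρ²)·nsq B` for any fine minimiser selection `G_f`).
HONEST SCOPE.  Abstract; instantiated at `U = 1` by `WhitneyRowDefectGauge` ∕ `…Bound(Decay)` ∕ `…End(Free)`; the `U ≠ 1` inputs ((PROL)∕(MONO) with background, Bałaban's
minimiser selections) are NOT here.  NOT (CONV-C), NOT D1, NOT `BetaPertH`, NOT continuum, NOT Clay; NEVER «G-an2-4 closed».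
-/

noncomputable section

namespace Summit.QuantumFields.BalabanUV.Beta.GAN24.MonotoneSqueezeGauge

open Matrix
open scoped ComplexOrder Matrix.Norms.L2Operator
open Literature.MathematicalPhysics.QuantumFieldTheory.Balaban1983to89.B5Prop11Lower (nsq nsq_nonneg)
open Summit.QuantumFields.BalabanUV.Beta.GAN24.MonotoneShorted (harmExt shortForm shortForm_quad quad_harmExt_add C_harmExt_mulVec shortForm_quad_le
  shortForm_mulVec_eq_zero_of_lift shortForm_isHermitian shortForm_posSemidef ker_pairing)
open Summit.QuantumFields.BalabanUV.Beta.GAN24.MonotoneSqueeze (rowDefect trial squeeze energy_dist_trial_le re_pairing_le_opNorm)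

variable {ι₀ ι₁ κ : Type*} [Fintype ι₀] [DecidableEq ι₀] [Fintype ι₁] [DecidableEq ι₁] [Fintype κ] [DecidableEq κ]
variable {Hc : Matrix ι₀ ι₀ ℂ} {Hf : Matrix ι₁ ι₁ ℂ}

/-! ## §1 Two minimisers on one fibre differ by a null vector -/

/-- **ANY MINIMISER SELECTION DIFFERS FROM `harmExt` BY A NULL VECTOR**: if `C_c G = 1` and `G B` has energy at most the minimum `re⟨B, E_c B⟩`, then
`H_c (harmExt_c B − G B) = 0` (Pythagoras on the fibre: `⟨GB, H GB⟩ = ⟨harmExt B, H harmExt B⟩ + ⟨z, Hz⟩`, `z = GB − harmExt B`, and `⟨z, Hz⟩ ≥ 0` is then `0`). [folklore] -/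
theorem H_harmExt_sub_mulVec_eq_zero (hHc : Hc.PosSemidef) {Cc : Matrix κ ι₀ ℂ} {Sc : Matrix ι₀ κ ℂ} (hSc : Cc * Sc = 1) {G : Matrix ι₀ κ ℂ} (hG : Cc * G = 1)
    (B : κ → ℂ) (hmin : (star (G *ᵥ B) ⬝ᵥ (Hc *ᵥ (G *ᵥ B))).re ≤ (star B ⬝ᵥ (shortForm hHc.isHermitian Cc Sc *ᵥ B)).re) :
    Hc *ᵥ (harmExt hHc.isHermitian Cc Sc *ᵥ B - G *ᵥ B) = 0 := by
  set h := harmExt hHc.isHermitian Cc Sc *ᵥ B with hh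
  set A := G *ᵥ B with hA
  have hw : Cc *ᵥ (A - h) = 0 := by
    rw [mulVec_sub, hA, hh, mulVec_mulVec, hG, one_mulVec, C_harmExt_mulVec _ hSc, sub_self]
  have hpy := quad_harmExt_add hHc Cc Sc B hw
  rw [← hh, show h + (A - h) = A by abel] at hpy
  have hE : star h ⬝ᵥ (Hc *ᵥ h) = star B ⬝ᵥ (shortForm hHc.isHermitian Cc Sc *ᵥ B) := by rw [hh, shortForm_quad]
  -- `⟨z, Hz⟩` is a nonnegative real; its real part is `≤ 0`
  have hnn := hHc.dotProduct_mulVec_nonneg (A - h)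
  obtain ⟨hre, him⟩ := Complex.nonneg_iff.mp hnn
  have hre' : (star (A - h) ⬝ᵥ (Hc *ᵥ (A - h))).re ≤ 0 := by
    have := congrArg Complex.re hpy
    rw [Complex.add_re, hE] at this
    linarith
  have hz : star (A - h) ⬝ᵥ (Hc *ᵥ (A - h)) = 0 := by
    apply Complex.ext
    · rw [Complex.zero_re]; linarith
    · rw [Complex.zero_im]; exact him.symm
  have hz' := (hHc.dotProduct_mulVec_zero_iff (A - h)).mp hz
  rw [show h - A = -(A - h) by abel, mulVec_neg, hz', neg_zero]

/-! ## §2 (PROL) maps null vectors to null vectors; the fine shorted form kills their readings -/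

omit [DecidableEq ι₀] [DecidableEq ι₁] in
/-- **(PROL) PRESERVES NULL VECTORS**: `re⟨Pu, H_f Pu⟩ ≤ re⟨u, H_c u⟩` for all `u` and `H_c z = 0` ⟹ `H_f (P z) = 0`. [folklore] -/
theorem Hf_P_mulVec_of_ker (hHf : Hf.PosSemidef) {P : Matrix ι₁ ι₀ ℂ}
    (hprol : ∀ u : ι₀ → ℂ, (star (P *ᵥ u) ⬝ᵥ (Hf *ᵥ (P *ᵥ u))).re ≤ (star u ⬝ᵥ (Hc *ᵥ u)).re) {z : ι₀ → ℂ} (hz : Hc *ᵥ z = 0) :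
    Hf *ᵥ (P *ᵥ z) = 0 := by
  have hle := hprol z
  rw [hz, dotProduct_zero, Complex.zero_re] at hle
  have hnn := hHf.dotProduct_mulVec_nonneg (P *ᵥ z)
  obtain ⟨hre, him⟩ := Complex.nonneg_iff.mp hnn
  have hq : star (P *ᵥ z) ⬝ᵥ (Hf *ᵥ (P *ᵥ z)) = 0 := by
    apply Complex.ext
    · rw [Complex.zero_re]; linarith
    · rw [Complex.zero_im]; exact him.symm
  exact (hHf.dotProduct_mulVec_zero_iff _).mp hq

omit [DecidableEq ι₀] in
/-- **THE FINE SHORTED FORM KILLS THE READING OF A PROLONGATED NULL VECTOR**: `H_c z = 0 ⟹ E_f (C_f (P z)) = 0`. [folklore] -/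
theorem shortForm_Cf_P_of_ker (hHf : Hf.PosSemidef) {Cf : Matrix κ ι₁ ℂ} {Sf : Matrix ι₁ κ ℂ} (hSf : Cf * Sf = 1) {P : Matrix ι₁ ι₀ ℂ}
    (hprol : ∀ u : ι₀ → ℂ, (star (P *ᵥ u) ⬝ᵥ (Hf *ᵥ (P *ᵥ u))).re ≤ (star u ⬝ᵥ (Hc *ᵥ u)).re) {z : ι₀ → ℂ} (hz : Hc *ᵥ z = 0) :
    shortForm hHf.isHermitian Cf Sf *ᵥ (Cf *ᵥ (P *ᵥ z)) = 0 :=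
  shortForm_mulVec_eq_zero_of_lift hHf hSf rfl (Hf_P_mulVec_of_ker hHf hprol hz)

/-! ## §3 The gauge split of the row defect inside the fine effective form -/

section Split

variable (hHc : Hc.PosSemidef) (hHf : Hf.PosSemidef) {Cc : Matrix κ ι₀ ℂ} {Sc : Matrix ι₀ κ ℂ} {Cf : Matrix κ ι₁ ℂ} {Sf : Matrix ι₁ κ ℂ} {P : Matrix ι₁ ι₀ ℂ}
  {G : Matrix ι₀ κ ℂ}

/-- **THE GAUGE SPLIT, LINEAR FORM**: `E_f (R B) = E_f (C_f P G B − B)` for every minimiser selection `G` (at `B`). [folklore] -/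
theorem shortForm_rowDefect_mulVec_eq (hSc : Cc * Sc = 1) (hSf : Cf * Sf = 1)
    (hprol : ∀ u : ι₀ → ℂ, (star (P *ᵥ u) ⬝ᵥ (Hf *ᵥ (P *ᵥ u))).re ≤ (star u ⬝ᵥ (Hc *ᵥ u)).re) (hG : Cc * G = 1) (B : κ → ℂ)
    (hmin : (star (G *ᵥ B) ⬝ᵥ (Hc *ᵥ (G *ᵥ B))).re ≤ (star B ⬝ᵥ (shortForm hHc.isHermitian Cc Sc *ᵥ B)).re) :
    shortForm hHf.isHermitian Cf Sf *ᵥ (rowDefect hHc.isHermitian Cc Sc Cf P *ᵥ B)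
      = shortForm hHf.isHermitian Cf Sf *ᵥ (Cf *ᵥ (P *ᵥ (G *ᵥ B)) - B) := by
  have e : rowDefect hHc.isHermitian Cc Sc Cf P *ᵥ B
      = (Cf *ᵥ (P *ᵥ (G *ᵥ B)) - B) + Cf *ᵥ (P *ᵥ (harmExt hHc.isHermitian Cc Sc *ᵥ B - G *ᵥ B)) := by
    rw [rowDefect, sub_mulVec, one_mulVec, ← mulVec_mulVec, ← mulVec_mulVec, mulVec_sub P, mulVec_sub Cf]; abel
  rw [e, mulVec_add, shortForm_Cf_P_of_ker hHf hSf hprol (H_harmExt_sub_mulVec_eq_zero hHc hSc hG B hmin), add_zero]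

/-- **THE GAUGE SPLIT, QUADRATIC FORM**: `⟨R B, E_f (R B)⟩ = ⟨δ, E_f δ⟩`, `δ = C_f P G B − B`. [folklore] -/
theorem rowDefect_quad_eq (hSc : Cc * Sc = 1) (hSf : Cf * Sf = 1)
    (hprol : ∀ u : ι₀ → ℂ, (star (P *ᵥ u) ⬝ᵥ (Hf *ᵥ (P *ᵥ u))).re ≤ (star u ⬝ᵥ (Hc *ᵥ u)).re) (hG : Cc * G = 1) (B : κ → ℂ)
    (hmin : (star (G *ᵥ B) ⬝ᵥ (Hc *ᵥ (G *ᵥ B))).re ≤ (star B ⬝ᵥ (shortForm hHc.isHermitian Cc Sc *ᵥ B)).re) :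
    star (rowDefect hHc.isHermitian Cc Sc Cf P *ᵥ B) ⬝ᵥ (shortForm hHf.isHermitian Cf Sf *ᵥ (rowDefect hHc.isHermitian Cc Sc Cf P *ᵥ B))
      = star (Cf *ᵥ (P *ᵥ (G *ᵥ B)) - B) ⬝ᵥ (shortForm hHf.isHermitian Cf Sf *ᵥ (Cf *ᵥ (P *ᵥ (G *ᵥ B)) - B)) := by
  have e : rowDefect hHc.isHermitian Cc Sc Cf P *ᵥ B
      = (Cf *ᵥ (P *ᵥ (G *ᵥ B)) - B) + Cf *ᵥ (P *ᵥ (harmExt hHc.isHermitian Cc Sc *ᵥ B - G *ᵥ B)) := by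
    rw [rowDefect, sub_mulVec, one_mulVec, ← mulVec_mulVec, ← mulVec_mulVec, mulVec_sub P, mulVec_sub Cf]; abel
  rw [shortForm_rowDefect_mulVec_eq hHc hHf hSc hSf hprol hG B hmin, e, star_add, add_dotProduct,
    ker_pairing (shortForm_isHermitian hHf.isHermitian Cf Sf)
      (shortForm_Cf_P_of_ker hHf hSf hprol (H_harmExt_sub_mulVec_eq_zero hHc hSc hG B hmin)), add_zero]

/-! ## §4 Road P2's ENDs with the honest defect of an arbitrary minimiser selection -/

/-- **THE SQUEEZE, GAUGE-SPLIT FORM**: under (PROL) and (MONO), `0 ≤ re⟨B,(E_f − E_c)B⟩ ≤ −2·re⟨B, E_f (C_f P G B − B)⟩`. [folklore] -/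
theorem squeeze_gauge (hSc : Cc * Sc = 1) (hSf : Cf * Sf = 1)
    (hprol : ∀ u : ι₀ → ℂ, (star (P *ᵥ u) ⬝ᵥ (Hf *ᵥ (P *ᵥ u))).re ≤ (star u ⬝ᵥ (Hc *ᵥ u)).re)
    (hmono : (shortForm hHf.isHermitian Cf Sf - shortForm hHc.isHermitian Cc Sc).PosSemidef) (hG : Cc * G = 1) (B : κ → ℂ)
    (hmin : (star (G *ᵥ B) ⬝ᵥ (Hc *ᵥ (G *ᵥ B))).re ≤ (star B ⬝ᵥ (shortForm hHc.isHermitian Cc Sc *ᵥ B)).re) :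
    0 ≤ (star B ⬝ᵥ ((shortForm hHf.isHermitian Cf Sf - shortForm hHc.isHermitian Cc Sc) *ᵥ B)).re
      ∧ (star B ⬝ᵥ ((shortForm hHf.isHermitian Cf Sf - shortForm hHc.isHermitian Cc Sc) *ᵥ B)).re
          ≤ -2 * (star B ⬝ᵥ (shortForm hHf.isHermitian Cf Sf *ᵥ (Cf *ᵥ (P *ᵥ (G *ᵥ B)) - B))).re := by
  have h := squeeze (Sc := Sc) hHc hHf hSf hprol hmono B
  rw [shortForm_rowDefect_mulVec_eq hHc hHf hSc hSf hprol hG B hmin] at h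
  exact h

/-- **THE ENERGY DISTANCE, GAUGE-SPLIT FORM**: road P2's trial field is within `−2re⟨B, E_f δ⟩ − re⟨δ, E_f δ⟩` of the fine canonical minimiser in energy, `δ = C_f P G B − B`. [folklore] -/
theorem energy_dist_gauge (hSc : Cc * Sc = 1) (hSf : Cf * Sf = 1)
    (hprol : ∀ u : ι₀ → ℂ, (star (P *ᵥ u) ⬝ᵥ (Hf *ᵥ (P *ᵥ u))).re ≤ (star u ⬝ᵥ (Hc *ᵥ u)).re)
    (hmono : (shortForm hHf.isHermitian Cf Sf - shortForm hHc.isHermitian Cc Sc).PosSemidef) (hG : Cc * G = 1) (B : κ → ℂ)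
    (hmin : (star (G *ᵥ B) ⬝ᵥ (Hc *ᵥ (G *ᵥ B))).re ≤ (star B ⬝ᵥ (shortForm hHc.isHermitian Cc Sc *ᵥ B)).re) :
    (star (trial hHc.isHermitian hHf.isHermitian Cc Sc Cf Sf P *ᵥ B - harmExt hHf.isHermitian Cf Sf *ᵥ B) ⬝ᵥ
        (Hf *ᵥ (trial hHc.isHermitian hHf.isHermitian Cc Sc Cf Sf P *ᵥ B - harmExt hHf.isHermitian Cf Sf *ᵥ B))).re
      ≤ -2 * (star B ⬝ᵥ (shortForm hHf.isHermitian Cf Sf *ᵥ (Cf *ᵥ (P *ᵥ (G *ᵥ B)) - B))).re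
        - (star (Cf *ᵥ (P *ᵥ (G *ᵥ B)) - B) ⬝ᵥ (shortForm hHf.isHermitian Cf Sf *ᵥ (Cf *ᵥ (P *ᵥ (G *ᵥ B)) - B))).re := by
  have h := energy_dist_trial_le (Sc := Sc) hHc hHf hSf hprol hmono B
  rw [rowDefect_quad_eq hHc hHf hSc hSf hprol hG B hmin, shortForm_rowDefect_mulVec_eq hHc hHf hSc hSf hprol hG B hmin] at h
  exact h

/-- **NORM FORM, GAUGE-SPLIT**: `‖E_f‖ ≤ Λ` and `nsq (C_f P G B − B) ≤ ρ²·nsq B` (`ρ ≥ 0`) give the value step `≤ 2Λρ·nsq B`, the energy distance `≤ 2Λρ·nsq B` and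
`re⟨δ, E_f δ⟩ ≤ Λρ²·nsq B`. [folklore] -/
theorem squeeze_nsq_gauge (hSc : Cc * Sc = 1) (hSf : Cf * Sf = 1)
    (hprol : ∀ u : ι₀ → ℂ, (star (P *ᵥ u) ⬝ᵥ (Hf *ᵥ (P *ᵥ u))).re ≤ (star u ⬝ᵥ (Hc *ᵥ u)).re)
    (hmono : (shortForm hHf.isHermitian Cf Sf - shortForm hHc.isHermitian Cc Sc).PosSemidef) (hG : Cc * G = 1) (B : κ → ℂ)
    (hmin : (star (G *ᵥ B) ⬝ᵥ (Hc *ᵥ (G *ᵥ B))).re ≤ (star B ⬝ᵥ (shortForm hHc.isHermitian Cc Sc *ᵥ B)).re)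
    {Λ ρ : ℝ} (hΛ : ‖shortForm hHf.isHermitian Cf Sf‖ ≤ Λ) (hρ : 0 ≤ ρ) (hδ : nsq (Cf *ᵥ (P *ᵥ (G *ᵥ B)) - B) ≤ ρ ^ 2 * nsq B) :
    (star B ⬝ᵥ ((shortForm hHf.isHermitian Cf Sf - shortForm hHc.isHermitian Cc Sc) *ᵥ B)).re ≤ 2 * Λ * ρ * nsq B
      ∧ (star (trial hHc.isHermitian hHf.isHermitian Cc Sc Cf Sf P *ᵥ B - harmExt hHf.isHermitian Cf Sf *ᵥ B) ⬝ᵥ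
            (Hf *ᵥ (trial hHc.isHermitian hHf.isHermitian Cc Sc Cf Sf P *ᵥ B - harmExt hHf.isHermitian Cf Sf *ᵥ B))).re ≤ 2 * Λ * ρ * nsq B
      ∧ (star (Cf *ᵥ (P *ᵥ (G *ᵥ B)) - B) ⬝ᵥ (shortForm hHf.isHermitian Cf Sf *ᵥ (Cf *ᵥ (P *ᵥ (G *ᵥ B)) - B))).re ≤ Λ * ρ ^ 2 * nsq B := by
  set Ef := shortForm hHf.isHermitian Cf Sf with hEf
  set r := Cf *ᵥ (P *ᵥ (G *ᵥ B)) - B with hr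
  have hcs := re_pairing_le_opNorm Ef B r
  have hcs2 := re_pairing_le_opNorm Ef r r
  have hsq : Real.sqrt (nsq r) ≤ ρ * Real.sqrt (nsq B) := by
    calc Real.sqrt (nsq r) ≤ Real.sqrt (ρ ^ 2 * nsq B) := Real.sqrt_le_sqrt hδ
      _ = ρ * Real.sqrt (nsq B) := by rw [Real.sqrt_mul (sq_nonneg _), Real.sqrt_sq hρ]
  have hΛ0 : 0 ≤ Λ := (norm_nonneg _).trans hΛ
  have hB0 : 0 ≤ Real.sqrt (nsq B) := Real.sqrt_nonneg _
  have hr0 : 0 ≤ Real.sqrt (nsq r) := Real.sqrt_nonneg _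
  have hBB : Real.sqrt (nsq B) * Real.sqrt (nsq B) = nsq B := Real.mul_self_sqrt (nsq_nonneg B)
  have hmain : |(star B ⬝ᵥ (Ef *ᵥ r)).re| ≤ Λ * ρ * nsq B := by
    calc |(star B ⬝ᵥ (Ef *ᵥ r)).re| ≤ ‖Ef‖ * Real.sqrt (nsq B) * Real.sqrt (nsq r) := hcs
      _ ≤ Λ * Real.sqrt (nsq B) * (ρ * Real.sqrt (nsq B)) := mul_le_mul (mul_le_mul_of_nonneg_right hΛ hB0) hsq hr0 (mul_nonneg hΛ0 hB0)
      _ = Λ * ρ * (Real.sqrt (nsq B) * Real.sqrt (nsq B)) := by ring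
      _ = Λ * ρ * nsq B := by rw [hBB]
  have hmain2 : |(star r ⬝ᵥ (Ef *ᵥ r)).re| ≤ Λ * ρ ^ 2 * nsq B := by
    calc |(star r ⬝ᵥ (Ef *ᵥ r)).re| ≤ ‖Ef‖ * Real.sqrt (nsq r) * Real.sqrt (nsq r) := hcs2
      _ ≤ Λ * (ρ * Real.sqrt (nsq B)) * (ρ * Real.sqrt (nsq B)) := mul_le_mul (mul_le_mul hΛ hsq hr0 hΛ0) hsq hr0 (mul_nonneg hΛ0 (mul_nonneg hρ hB0))
      _ = Λ * ρ ^ 2 * (Real.sqrt (nsq B) * Real.sqrt (nsq B)) := by ring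
      _ = Λ * ρ ^ 2 * nsq B := by rw [hBB]
  have hsq2 := (squeeze_gauge hHc hHf hSc hSf hprol hmono hG B hmin).2
  have hed := energy_dist_gauge hHc hHf hSc hSf hprol hmono hG B hmin
  rw [← hEf, ← hr] at hsq2 hed
  have hrr : 0 ≤ (star r ⬝ᵥ (Ef *ᵥ r)).re := (Complex.nonneg_iff.mp ((shortForm_posSemidef hHf Cf Sf).dotProduct_mulVec_nonneg r)).1
  have hab := (abs_le.mp hmain).1
  have hab2 := (abs_le.mp hmain2).2
  exact ⟨by linarith, by linarith, hab2⟩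

/-- **THE TWO MINIMISER SELECTIONS ARE ENERGY-CLOSE** (modulo `Λ`, `ρ`): for any fine selection `G_f` (`C_f G_f = 1`, minimality at `B`) and coarse selection `G` as above,
`re⟨G_f B − P G B, H_f (G_f B − P G B)⟩ ≤ (4Λρ + 2Λρ²)·nsq B` — the abstract form of the Cauchy property of `WhitneyRowDefectGauge.curlEnergy_HkOp_succ_sub_PcoLev_le`. [folklore] -/
theorem energy_dist_minimisers (hSc : Cc * Sc = 1) (hSf : Cf * Sf = 1)
    (hprol : ∀ u : ι₀ → ℂ, (star (P *ᵥ u) ⬝ᵥ (Hf *ᵥ (P *ᵥ u))).re ≤ (star u ⬝ᵥ (Hc *ᵥ u)).re)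
    (hmono : (shortForm hHf.isHermitian Cf Sf - shortForm hHc.isHermitian Cc Sc).PosSemidef) (hG : Cc * G = 1) (B : κ → ℂ)
    (hmin : (star (G *ᵥ B) ⬝ᵥ (Hc *ᵥ (G *ᵥ B))).re ≤ (star B ⬝ᵥ (shortForm hHc.isHermitian Cc Sc *ᵥ B)).re)
    {Gf : Matrix ι₁ κ ℂ} (hGf : Cf * Gf = 1) (hminf : (star (Gf *ᵥ B) ⬝ᵥ (Hf *ᵥ (Gf *ᵥ B))).re ≤ (star B ⬝ᵥ (shortForm hHf.isHermitian Cf Sf *ᵥ B)).re)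
    {Λ ρ : ℝ} (hΛ : ‖shortForm hHf.isHermitian Cf Sf‖ ≤ Λ) (hρ : 0 ≤ ρ) (hδ : nsq (Cf *ᵥ (P *ᵥ (G *ᵥ B)) - B) ≤ ρ ^ 2 * nsq B) :
    (star (Gf *ᵥ B - P *ᵥ (G *ᵥ B)) ⬝ᵥ (Hf *ᵥ (Gf *ᵥ B - P *ᵥ (G *ᵥ B)))).re ≤ (4 * Λ * ρ + 2 * Λ * ρ ^ 2) * nsq B := by
  obtain ⟨-, hdist, hquad⟩ := squeeze_nsq_gauge hHc hHf hSc hSf hprol hmono hG B hmin hΛ hρ hδ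
  set t := trial hHc.isHermitian hHf.isHermitian Cc Sc Cf Sf P *ᵥ B with ht
  set h' := harmExt hHf.isHermitian Cf Sf *ᵥ B with hh'
  set hj := harmExt hHc.isHermitian Cc Sc *ᵥ B with hhj
  set r := rowDefect hHc.isHermitian Cc Sc Cf P *ᵥ B with hr
  have htr : t = P *ᵥ hj - harmExt hHf.isHermitian Cf Sf *ᵥ r := by
    rw [ht, trial, sub_mulVec, ← mulVec_mulVec, ← mulVec_mulVec, ← hhj, hr]
  -- the null bracket
  have hK : Hf *ᵥ ((Gf *ᵥ B - h') + P *ᵥ (hj - G *ᵥ B)) = 0 := by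
    rw [mulVec_add, show Gf *ᵥ B - h' = -(h' - Gf *ᵥ B) by abel, mulVec_neg, hh', H_harmExt_sub_mulVec_eq_zero hHf hSf hGf B hminf, neg_zero,
      zero_add, hhj]
    exact Hf_P_mulVec_of_ker hHf hprol (H_harmExt_sub_mulVec_eq_zero hHc hSc hG B hmin)
  have hX : Gf *ᵥ B - P *ᵥ (G *ᵥ B) = -((t - h') + harmExt hHf.isHermitian Cf Sf *ᵥ r) + ((Gf *ᵥ B - h') + P *ᵥ (hj - G *ᵥ B)) := by
    rw [htr, mulVec_sub]; abel
  have hnull : ∀ u k : ι₁ → ℂ, Hf *ᵥ k = 0 → star (u + k) ⬝ᵥ (Hf *ᵥ (u + k)) = star u ⬝ᵥ (Hf *ᵥ u) := fun u k hk => by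
    rw [mulVec_add, hk, add_zero, star_add, add_dotProduct, ker_pairing hHf.isHermitian hk u, add_zero]
  have hq1 : star (Gf *ᵥ B - P *ᵥ (G *ᵥ B)) ⬝ᵥ (Hf *ᵥ (Gf *ᵥ B - P *ᵥ (G *ᵥ B)))
      = star ((t - h') + harmExt hHf.isHermitian Cf Sf *ᵥ r) ⬝ᵥ (Hf *ᵥ ((t - h') + harmExt hHf.isHermitian Cf Sf *ᵥ r)) := by
    rw [hX, hnull _ _ hK, mulVec_neg, star_neg, neg_dotProduct, dotProduct_neg, neg_neg]
  have hq2 : ∀ a b : ι₁ → ℂ, (star (a + b) ⬝ᵥ (Hf *ᵥ (a + b))).re ≤ 2 * (star a ⬝ᵥ (Hf *ᵥ a)).re + 2 * (star b ⬝ᵥ (Hf *ᵥ b)).re := by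
    intro a b
    have hpar : star (a + b) ⬝ᵥ (Hf *ᵥ (a + b)) + star (a - b) ⬝ᵥ (Hf *ᵥ (a - b)) = 2 * (star a ⬝ᵥ (Hf *ᵥ a)) + 2 * (star b ⬝ᵥ (Hf *ᵥ b)) := by
      simp only [mulVec_add, mulVec_sub, star_add, star_sub, add_dotProduct, sub_dotProduct, dotProduct_add, dotProduct_sub]; ring
    have hre := congrArg Complex.re hpar
    simp only [Complex.add_re, Complex.mul_re, Complex.re_ofNat, Complex.im_ofNat, zero_mul, sub_zero] at hre
    have hnn : 0 ≤ (star (a - b) ⬝ᵥ (Hf *ᵥ (a - b))).re := (Complex.nonneg_iff.mp (hHf.dotProduct_mulVec_nonneg _)).1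
    linarith
  have hq3 : star (harmExt hHf.isHermitian Cf Sf *ᵥ r) ⬝ᵥ (Hf *ᵥ (harmExt hHf.isHermitian Cf Sf *ᵥ r))
      = star (Cf *ᵥ (P *ᵥ (G *ᵥ B)) - B) ⬝ᵥ (shortForm hHf.isHermitian Cf Sf *ᵥ (Cf *ᵥ (P *ᵥ (G *ᵥ B)) - B)) := by
    rw [← shortForm_quad, hr, ← rowDefect_quad_eq hHc hHf hSc hSf hprol hG B hmin]
  have hfin : (star (Gf *ᵥ B - P *ᵥ (G *ᵥ B)) ⬝ᵥ (Hf *ᵥ (Gf *ᵥ B - P *ᵥ (G *ᵥ B)))).re ≤ (4 * Λ * ρ + 2 * Λ * ρ ^ 2) * nsq B := by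
    rw [hq1]
    refine (hq2 _ _).trans ?_
    rw [hq3]
    linarith [hdist, hquad]
  exact hfin

end Split

end Summit.QuantumFields.BalabanUV.Beta.GAN24.MonotoneSqueezeGauge

end
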